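import Summits.SmoothPoincare4.SmoothPoincare4.Theses.EntropyRung
import Summits.SmoothPoincare4.SmoothPoincare4.Theorems.EntropyRungNoncompactGapReduction

/-!
# Route EntropyRung — `UnboundedCurvatureGap` (item stmt-SmoothPoincare4-16590): reductions

The item is the density gap `∫ e^{-f} dV ≤ 32π²√π e^{-3/2} = (4π)² Θ(S³×ℝ)` for complete connected non-compact
non-flat normalised 4-d gradient shrinking Ricci solitons (`Ric + Hess f = g/2`, `R + |∇f|² = f`) whose scalar
curvature is UNBOUNDED (`¬ ∃ C, R ≤ C`) — residue 2 of the crux `NoncompactShrinkerGap` of line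
`collapsed-ends-usc`. Its content is an OPEN PROBLEM: no complete gradient shrinker with unbounded curvature is
known in any dimension, and no theorem in print bounds the Gaussian density on this class (Munteanu–Wang 2015:
`|Rm| ≤ cR` only for bounded `R`; Chow–Freedman–Shin–Zhang 2020: quadratic curvature growth for singularity
models; Cao's survey arXiv:2510.06059 §§1, 6: the curvature bound without the hypothesis `R ≤ R₀` is open;
Bertellotti–Buzano arXiv:2508.10790 Thm 1.8: ends along a gradient curve on which `S` is Type I only).

This helper file (`--supports stmt-SmoothPoincare4-16590`) records, kernel-checked and over the route's own
vocabulary (no definition, no named fact introduced), the three implications by which the item WOULD close: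

* `unboundedCurvatureGap_of_boundedScalarCurvature` — if every complete 4-d gradient shrinking Ricci soliton has
  bounded scalar curvature (the open question left by Munteanu–Wang 2015 / Cao–Ribeiro–Zhou 2021 / CFSZ 2020), the
  class is EMPTY and the item holds vacuously;
* `unboundedCurvatureGap_of_unboundedSplitting` — if a shrinker of the class SPLITS AT INFINITY at scale one (the
  export of the route item `ShrinkerSplittingAtInfinity`, i.e. of `shrinkerSplittingAtInfinity_four`, with its two
  curvature provisos "bounded, non-decaying" replaced by "unbounded": a complete non-flat normalised 3-d shrinker
  `N` and `(1±η)`-transplants of the pieces `{φ < R₀} × (−R₀, R₀)` of `N × ℝ` into `M`), then the LANDED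
  Bernstein–Wang lever of the line (U1 `log_le_functional_of_lsi`, U2 `stub_modelValueSplitLine_of_nonneg`, U3
  `stub_transplantComparison`, Carrillo–Ni (i)) gives `∫_M e^{-f} ≤ 2√π ∫_N e^{-φ}` from the textbook LSI
  `BakryEmeryLogSobolev`, and the 3-d rung `ThreeShrinkerGap` caps it by `2√π · 16π² e^{-3/2}` — none of the
  lever's analysis uses the bound `R ≤ C` (only `R ≥ 0`, a theorem: `shrinkerScalarCurvature_nonneg_holds`);
* `unboundedCurvatureGap_of_blowdownComparison` — if the class admits the BLOW-DOWN COMPARISON typed by the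
  line's wave-1 worker (`sup R = ∞ ⇒ ∫_M e^{-f} ≤ 8π²` (a flat-quotient or orbifold blow-down, `Θ ≤ 1/2`) `∨`
  `∃` a complete non-flat normalised 3-d shrinker `N` with `∫_M e^{-f} ≤ 2√π ∫_N e^{-φ}` (a split blow-down)),
  the item is arithmetic `∨` `ThreeShrinkerGap` (`8π² ≤ 32π²√π e^{-3/2}` is `eightPiSq_le_cylinderBound`).

Also recorded: the non-flatness hypothesis of the item is idle (`exists_ne_zero_of_not_bounded`: unbounded `R`
is not identically zero).

## References

* O. Munteanu, J. Wang, *Geometry of shrinking Ricci solitons*, Compos. Math. 151 (2015) 2273–2300, Thm 1.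
  [MunteanuWang2015]
* B. Chow, M. Freedman, H. Shin, Y. Zhang, *Curvature growth of some 4-dimensional gradient Ricci soliton
  singularity models*, Adv. Math. 372 (2020), Thm 1.4 (arXiv:1903.09181).
* H.-D. Cao, *On curvature estimates for four-dimensional gradient Ricci solitons*, Mat. Contemp. 49 (2022)
  87–139 = arXiv:2510.06059, §1 and §6 (Question 4, Remark 6.5).
* A. Bertellotti, R. Buzano, *Geometric structure of ends of Ricci shrinkers*, arXiv:2508.10790, Thm 1.8.
  [BertellottiBuzano2025]
* J. Bernstein, L. Wang, Invent. Math. 206 (2016), Thm 1.2. [BernsteinWang2016]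
* H.-D. Cao, R. S. Hamilton, T. Ilmanen, arXiv:math/0404165 (2004), §§3–4. [CaoHamiltonIlmanen2004]
-/

noncomputable section

-- the registered namespace `Summit.SmoothPoincare4.SmoothPoincare4.…` repeats a component (summit = problem)
set_option linter.dupNamespace false

open scoped Manifold ContDiff ENNReal NNReal Topology
open MeasureTheory Set Filter
open Literature.Geometry.Lorentzian Literature.Geometry.Riemannian

namespace Summit.SmoothPoincare4.SmoothPoincare4.Theorems.UnboundedCurvatureGapReductions

open Summit.SmoothPoincare4.SmoothPoincare4.Theses.EntropyRung
open Summit.SmoothPoincare4.SmoothPoincare4.Theorems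
open Summit.SmoothPoincare4.SmoothPoincare4.Theorems.NoncompactShrinkerGapReduction
open Summit.SmoothPoincare4.SmoothPoincare4.Theorems.NoncompactShrinkerGapReductionTextbook

/-! ## Elementary facts -/

/-- A real function that is not bounded above is not identically zero — the non-flatness hypothesis
`∃ x, R x ≠ 0` of `UnboundedCurvatureGap` is implied by its unboundedness hypothesis. [folklore] -/
theorem exists_ne_zero_of_not_bounded {α : Type*} {R : α → ℝ} (h : ¬ ∃ C : ℝ, ∀ x, R x ≤ C) :
    ∃ x, R x ≠ 0 := by
  by_contra h0
  push Not at h0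
  exact h ⟨0, fun x ↦ (h0 x).le⟩

/-- `8π² ≤ 32π²√π e^{-3/2}`, i.e. `(4π)²/2 ≤ (4π)² Θ(S³×ℝ)` (`Θ(S³×ℝ) = 2√π e^{-3/2} ≈ .791 > 1/2`):
from `e^{3/2} = (e^{1/2})³ < (33/20)³ < 9/2` (`e < 2.7182818286 < (33/20)²`) and `√π > 17/10` (`π > 3 > 2.89`).
[cite: CaoHamiltonIlmanen2004, §4 (density table)] -/
theorem eightPiSq_le_cylinderBound :
    8 * Real.pi ^ 2 ≤ 32 * Real.pi ^ 2 * Real.sqrt Real.pi * Real.exp (-(3 : ℝ) / 2) := by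
  have hpi : 3 < Real.pi := Real.pi_gt_three
  have hsq : (17 : ℝ) / 10 < Real.sqrt Real.pi := by
    rw [show (17 : ℝ) / 10 = Real.sqrt ((17 / 10) ^ 2) by rw [Real.sqrt_sq (by norm_num)]]
    exact Real.sqrt_lt_sqrt (by norm_num) (by nlinarith)
  have hhalf : Real.exp (1 / 2 : ℝ) < 33 / 20 := by
    have h2 : Real.exp (1 / 2 : ℝ) ^ 2 = Real.exp 1 := by
      rw [← Real.exp_nat_mul]; norm_num
    have he : Real.exp 1 < 2.7182818286 := Real.exp_one_lt_d9
    nlinarith [Real.exp_pos (1 / 2 : ℝ)]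
  have h32 : Real.exp (3 / 2 : ℝ) < 9 / 2 := by
    have h3 : Real.exp (3 / 2 : ℝ) = Real.exp (1 / 2 : ℝ) ^ 3 := by
      rw [← Real.exp_nat_mul]; norm_num
    rw [h3]
    have h0 : 0 < Real.exp (1 / 2 : ℝ) := Real.exp_pos _
    nlinarith [mul_pos h0 h0]
  have hneg : Real.exp (-(3 : ℝ) / 2) = (Real.exp (3 / 2 : ℝ))⁻¹ := by
    rw [show (-(3 : ℝ) / 2) = -(3 / 2 : ℝ) by ring, Real.exp_neg]
  rw [hneg]
  have hpos : 0 < Real.exp (3 / 2 : ℝ) := Real.exp_pos _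
  rw [← sub_nonneg]
  have key : 8 * Real.pi ^ 2 * Real.exp (3 / 2 : ℝ) ≤ 32 * Real.pi ^ 2 * Real.sqrt Real.pi := by
    nlinarith [Real.pi_pos, mul_pos (mul_pos Real.pi_pos Real.pi_pos) hpos]
  have : 32 * Real.pi ^ 2 * Real.sqrt Real.pi * (Real.exp (3 / 2 : ℝ))⁻¹ - 8 * Real.pi ^ 2 =
      (32 * Real.pi ^ 2 * Real.sqrt Real.pi - 8 * Real.pi ^ 2 * Real.exp (3 / 2 : ℝ)) *
        (Real.exp (3 / 2 : ℝ))⁻¹ := by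
    field_simp
  rw [this]
  exact mul_nonneg (sub_nonneg.2 key) (inv_nonneg.2 hpos.le)

/-- **The non-flatness hypothesis of the item is idle**: `UnboundedCurvatureGap` already yields the bound for
data satisfying every hypothesis EXCEPT `∃ x, R x ≠ 0`, because unbounded scalar curvature is not identically zero
(`exists_ne_zero_of_not_bounded`). (Likewise idle, not recorded here: `[NoncompactSpace M]` — `R` is continuous,
`PseudoRiemannianMetric.contMDiff_scalarCurvature`, hence bounded on a compact `M` — and `[T3Space M]`.) Statement
hygiene for the planner; closes nothing. [folklore] -/
theorem withoutNonflat_of_unboundedCurvatureGap (hU : UnboundedCurvatureGap)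
    (M : Type) [TopologicalSpace M] [T2Space M] [SecondCountableTopology M]
    [ChartedSpace (EuclideanSpace ℝ (Fin 4)) M] [IsManifold (𝓡 4) ∞ M] [ConnectedSpace M] [NoncompactSpace M]
    [T3Space M] [MeasurableSpace M] [BorelSpace M]
    (g : PseudoRiemannianMetric (𝓡 4) ∞ (EuclideanSpace ℝ (Fin 4)) (TangentSpace (𝓡 4) : M → Type _))
    [g.HasLeviCivita] (f : M → ℝ) (hg : g.IsRiemannian)
    (hc : ∀ (x : M) (r : NNReal), IsCompact {y : M | g.edist hg x y ≤ r})
    (hf : ContMDiff (𝓡 4) 𝓘(ℝ, ℝ) ∞ f)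
    (hsol : ∀ (x : M) (X Y : TangentSpace (𝓡 4) x),
      g.ricci x X Y + g.hessian f x X Y = (1 / 2 : ℝ) * g.val x X Y)
    (hnorm : ∀ x : M, g.scalarCurvature x + g.gradSq f x = f x)
    (hunb : ¬ ∃ C : ℝ, ∀ x : M, g.scalarCurvature x ≤ C) :
    ∫⁻ x, ENNReal.ofReal (Real.exp (-f x)) ∂(riemannianMeasure (g.toContMDiffRiemannianMetric hg)) ≤
      ENNReal.ofReal (32 * Real.pi ^ 2 * Real.sqrt Real.pi * Real.exp (-(3 : ℝ) / 2)) :=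
  hU M g f hg hc hf hsol hnorm (exists_ne_zero_of_not_bounded hunb) hunb

/-! ## 1. Vacuity under bounded scalar curvature -/

/-- **`UnboundedCurvatureGap` from bounded scalar curvature of complete 4-d shrinkers.** If every complete
(closed `g.edist`-balls compact) 4-dimensional gradient shrinking Ricci soliton `Ric + Hess f = g/2` has bounded
scalar curvature — an OPEN question (Munteanu–Wang 2015 prove `|Rm| ≤ cR` GIVEN `R ≤ R₀`; Cao–Ribeiro–Zhou 2021
relax `R ≤ R₀` to a growth condition; Chow–Freedman–Shin–Zhang 2020 get quadratic curvature growth for singularity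
models; Cao, arXiv:2510.06059, §1 and §6 Question 4) — then the unbounded class is empty and the item holds
vacuously. The hypothesis is spelled minimally (no connectedness, normalisation or measure binders).
[cite: MunteanuWang2015, Thm 1] -/
theorem unboundedCurvatureGap_of_boundedScalarCurvature
    (hbdd : ∀ (M : Type) [TopologicalSpace M] [T2Space M] [SecondCountableTopology M]
      [ChartedSpace (EuclideanSpace ℝ (Fin 4)) M] [IsManifold (𝓡 4) ∞ M]
      (g : PseudoRiemannianMetric (𝓡 4) ∞ (EuclideanSpace ℝ (Fin 4)) (TangentSpace (𝓡 4) : M → Type _))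
      [g.HasLeviCivita] (f : M → ℝ) (hg : g.IsRiemannian),
      (∀ (x : M) (r : NNReal), IsCompact {y : M | g.edist hg x y ≤ r}) →
      ContMDiff (𝓡 4) 𝓘(ℝ, ℝ) ∞ f →
      (∀ (x : M) (X Y : TangentSpace (𝓡 4) x),
        g.ricci x X Y + g.hessian f x X Y = (1 / 2 : ℝ) * g.val x X Y) →
      ∃ C : ℝ, ∀ x : M, g.scalarCurvature x ≤ C) :
    UnboundedCurvatureGap := by
  intro M _ _ _ _ _ _ _ _ _ _ g _ f hg hc hf hsol _ _ hunb
  exact absurd (hbdd M g f hg hc hf hsol) hunb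

/-! ## 2. The Bernstein–Wang lever on the unbounded class -/

/-- **The lever of line `collapsed-ends-usc` needs no curvature bound.** For a complete connected non-compact
normalised 4-d gradient shrinker `(M, g, f)` and ANY complete connected normalised 3-d gradient shrinker
`(N, h, φ)` exporting `(1±η)`-transplants of the pieces `{φ < R₀} × (−R₀, R₀)` of `N × ℝ` into `M` for all `R₀`
and `η > 0` (the conclusion of `shrinkerSplittingAtInfinity_four`, as data), the textbook Bakry–Émery LSI gives
`∫_M e^{-f} dV_g ≤ 2√π ∫_N e^{-φ} dV_h`. Proof = the landed lever `collapsedDirectionReduction_of_textbook` with the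
call of the registered stub U1 (whose signature carries an unused `R ≤ C`) replaced by its curvature-free core
`log_le_functional_of_lsi`; U2, U3, Carrillo–Ni (i) and `R ≥ 0` (`shrinkerScalarCurvature_nonneg_holds`) as there.
[cite: BernsteinWang2016, Thm 1.2, Cor 6.6] -/
theorem lintegral_le_of_transplants (hBE : BakryEmeryLogSobolev)
    (M : Type) [TopologicalSpace M] [T2Space M] [SecondCountableTopology M]
    [ChartedSpace (EuclideanSpace ℝ (Fin 4)) M] [IsManifold (𝓡 4) ∞ M] [ConnectedSpace M] [NoncompactSpace M]
    [T3Space M] [MeasurableSpace M] [BorelSpace M]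
    (g : PseudoRiemannianMetric (𝓡 4) ∞ (EuclideanSpace ℝ (Fin 4)) (TangentSpace (𝓡 4) : M → Type _))
    [g.HasLeviCivita] (f : M → ℝ) (hg : g.IsRiemannian)
    (hc : ∀ (x : M) (r : NNReal), IsCompact {y : M | g.edist hg x y ≤ r})
    (hf : ContMDiff (𝓡 4) 𝓘(ℝ, ℝ) ∞ f)
    (hsol : ∀ (x : M) (X Y : TangentSpace (𝓡 4) x),
      g.ricci x X Y + g.hessian f x X Y = (1 / 2 : ℝ) * g.val x X Y)
    (hnorm : ∀ x : M, g.scalarCurvature x + g.gradSq f x = f x)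
    (N : Type) [TopologicalSpace N] [T2Space N] [SecondCountableTopology N]
    [ChartedSpace (EuclideanSpace ℝ (Fin 3)) N] [IsManifold (𝓡 3) ∞ N] [ConnectedSpace N] [T3Space N]
    [MeasurableSpace N] [BorelSpace N]
    (h : PseudoRiemannianMetric (𝓡 3) ∞ (EuclideanSpace ℝ (Fin 3)) (TangentSpace (𝓡 3) : N → Type _))
    [h.HasLeviCivita] (φ : N → ℝ) (hh : h.IsRiemannian)
    (hcN : ∀ (y : N) (r : NNReal), IsCompact {z : N | h.edist hh y z ≤ r})
    (hφ : ContMDiff (𝓡 3) 𝓘(ℝ, ℝ) ∞ φ)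
    (hsolN : ∀ (y : N) (X Y : TangentSpace (𝓡 3) y),
      h.ricci y X Y + h.hessian φ y X Y = (1 / 2 : ℝ) * h.val y X Y)
    (hnormN : ∀ y : N, h.scalarCurvature y + h.gradSq φ y = φ y)
    (htrans : ∀ R η : ℝ, 0 < η → ∃ (U : Set (N × ℝ)) (Φ : N × ℝ → M) (Ψ : M → N × ℝ), IsOpen U ∧
      {y : N | φ y < R} ×ˢ Set.Ioo (-R) R ⊆ U ∧ ContMDiffOn ((𝓡 3).prod 𝓘(ℝ, ℝ)) (𝓡 4) ∞ Φ U ∧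
      IsOpen (Φ '' U) ∧ ContMDiffOn (𝓡 4) ((𝓡 3).prod 𝓘(ℝ, ℝ)) ∞ Ψ (Φ '' U) ∧ (∀ p ∈ U, Ψ (Φ p) = p) ∧
      (∀ p ∈ U, ∀ (v : EuclideanSpace ℝ (Fin 3)) (s : ℝ),
        (1 - η) * (h.val p.1 v v + s ^ 2) ≤
            g.val (Φ p) (mfderiv ((𝓡 3).prod 𝓘(ℝ, ℝ)) (𝓡 4) Φ p (v, s))
              (mfderiv ((𝓡 3).prod 𝓘(ℝ, ℝ)) (𝓡 4) Φ p (v, s)) ∧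
          g.val (Φ p) (mfderiv ((𝓡 3).prod 𝓘(ℝ, ℝ)) (𝓡 4) Φ p (v, s))
              (mfderiv ((𝓡 3).prod 𝓘(ℝ, ℝ)) (𝓡 4) Φ p (v, s)) ≤ (1 + η) * (h.val p.1 v v + s ^ 2)) ∧
      (∀ p ∈ U, |g.scalarCurvature (Φ p) - h.scalarCurvature p.1| ≤ η)) :
    ∫⁻ x, ENNReal.ofReal (Real.exp (-f x)) ∂(riemannianMeasure (g.toContMDiffRiemannianMetric hg)) ≤
      ENNReal.ofReal (2 * Real.sqrt Real.pi) *
        ∫⁻ y, ENNReal.ofReal (Real.exp (-φ y)) ∂(riemannianMeasure (h.toContMDiffRiemannianMetric hh)) := by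
  have hX := shrinkerScalarCurvature_nonneg_holds
  have hCNff := shrinkerLSI_ff (bakryEmery_logSobolev_complete_of_item hBE)
  -- Carrillo–Ni (i) on `M` (`n = 4`) and on `N` (`n = 3`) — theorems
  have hAi : Integrable (fun x ↦ Real.exp (-f x)) g.riemVolume :=
    NoncompactShrinkerGapCarrilloNiClauses.carrilloNi_integrable_exp_neg g f hg hc hf hsol hnorm
  have hBi : Integrable (fun y ↦ Real.exp (-φ y)) h.riemVolume :=
    NoncompactShrinkerGapCarrilloNiClauses.carrilloNi_integrable_exp_neg h φ hh hcN hφ hsolN hnormN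
  have hApos : 0 < ∫ x, Real.exp (-f x) ∂g.riemVolume := integral_exp_neg_pos hg hAi
  have hBpos : 0 < ∫ y, Real.exp (-φ y) ∂h.riemVolume := integral_exp_neg_pos hh hBi
  have h2sqrtpi : 0 < 2 * Real.sqrt Real.pi := by positivity
  have hapos : 0 < (4 * Real.pi) ^ (-(4 : ℝ) / 2) := Real.rpow_pos_of_pos (by positivity) _
  have hlogA : Real.log ((4 * Real.pi) ^ (-(4 : ℝ) / 2)) = -Real.log ((4 * Real.pi) ^ 2) := by
    rw [show (-(4 : ℝ) / 2) = -(2 : ℝ) by norm_num, Real.rpow_neg (by positivity), Real.log_inv,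
      Real.rpow_two]
  -- the real inequality `∫_M e^{-f} ≤ 2√π ∫_N e^{-φ}` from U1 (curvature-free core), U2, U3, `ε` at a time
  have hmain : ∫ x, Real.exp (-f x) ∂g.riemVolume ≤
      2 * Real.sqrt Real.pi * ∫ y, Real.exp (-φ y) ∂h.riemVolume := by
    refine le_of_forall_log_mul_le hapos hApos (mul_pos h2sqrtpi hBpos) fun ε hε ↦ ?_
    obtain ⟨R, W, hWs, hWc, hWsupp, hWZ, hWval⟩ :=
      NoncompactShrinkerGapModelValueSplitLineOfNonneg.stub_modelValueSplitLine_of_nonneg hX N h φ hh hcN hφ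
        hsolN hnormN ε hε
    obtain ⟨η, hη, hη'⟩ :=
      NoncompactShrinkerGapTransplantComparison.stub_transplantComparison M g hg N h hh φ R W hWs hWc hWsupp
        hWZ ε hε
    obtain ⟨U, Φ, Ψ, hU, hsub, hΦ, hΦU, hΨ, hinv, hqi, hscal⟩ := htrans R η hη
    obtain ⟨w, hws, hwc, hwZ, hwval⟩ := hη' U Φ Ψ hU hsub hΦ hΦU hΨ hinv hqi hscal
    have h1 := NoncompactShrinkerGapCompactSupportLSIOfLSI.log_le_functional_of_lsi (n := 4) g f hg
      (hX 4 M g f hg hc hf hsol hnorm) (hCNff 4 M g f hg hc hf hsol hnorm) hc hf hsol hnorm hws hwc hwZ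
    simp only [Nat.cast_ofNat] at h1
    rw [hlogA] at h1
    linarith
  -- conversion to the route's `lintegral`s
  rw [lintegral_exp_neg_eq_ofReal_integral hg hAi, lintegral_exp_neg_eq_ofReal_integral hh hBi,
    ← ENNReal.ofReal_mul h2sqrtpi.le]
  exact ENNReal.ofReal_le_ofReal hmain

/-- **`UnboundedCurvatureGap` from splitting at infinity on the unbounded class**, over the route items
`ThreeShrinkerGap` and `BakryEmeryLogSobolev`. The first hypothesis is the export of
`ShrinkerSplittingAtInfinity` (= `shrinkerSplittingAtInfinity_four`, Munteanu–Wang 2015 + Enders–Müller–Topping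
2011 + Naber 2010 + Bertellotti–Buzano 2025) with its provisos "`R` bounded" and "`R` non-decaying" replaced by
"`R` unbounded": a complete connected non-flat normalised 3-d shrinker `(N, h, φ)` and `(1±η)`-transplants of the
pieces `{φ < R₀} × (−R₀, R₀)` of `N × ℝ` into `M`. NO theorem in print supplies it (Bertellotti–Buzano Thm 1.8
needs `S` Type I along one gradient curve to infinity; with it, any shrinker of the class having ONE gradient curve
with bounded non-decaying `S` is covered — the open residue is the class where every gradient curve to infinity
has `S → 0` or super-Type-I `S`). Given it, the lever `lintegral_le_of_transplants` and the 3-d rung finish: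
`∫_M e^{-f} ≤ 2√π ∫_N e^{-φ} ≤ 2√π · 16π² e^{-3/2} = 32π²√π e^{-3/2}`. Conditional record; closes nothing.
[cite: BernsteinWang2016, Thm 1.2] [cite: BertellottiBuzano2025, Thm 1.8] -/
theorem unboundedCurvatureGap_of_unboundedSplitting
    (hsplitU : ∀ (M : Type) [TopologicalSpace M] [T2Space M] [SecondCountableTopology M]
      [ChartedSpace (EuclideanSpace ℝ (Fin 4)) M] [IsManifold (𝓡 4) ∞ M] [ConnectedSpace M] [NoncompactSpace M]
      [T3Space M] [MeasurableSpace M] [BorelSpace M]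
      (g : PseudoRiemannianMetric (𝓡 4) ∞ (EuclideanSpace ℝ (Fin 4)) (TangentSpace (𝓡 4) : M → Type _))
      [g.HasLeviCivita] (f : M → ℝ) (hg : g.IsRiemannian),
      (∀ (x : M) (r : NNReal), IsCompact {y : M | g.edist hg x y ≤ r}) →
      ContMDiff (𝓡 4) 𝓘(ℝ, ℝ) ∞ f →
      (∀ (x : M) (X Y : TangentSpace (𝓡 4) x),
        g.ricci x X Y + g.hessian f x X Y = (1 / 2 : ℝ) * g.val x X Y) →
      (∀ x : M, g.scalarCurvature x + g.gradSq f x = f x) →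
      (¬ ∃ C : ℝ, ∀ x : M, g.scalarCurvature x ≤ C) →
      ∃ (N : Type) (_ : TopologicalSpace N) (_ : T2Space N) (_ : SecondCountableTopology N)
        (_ : ChartedSpace (EuclideanSpace ℝ (Fin 3)) N) (_ : IsManifold (𝓡 3) ∞ N) (_ : ConnectedSpace N)
        (_ : T3Space N) (_ : MeasurableSpace N) (_ : BorelSpace N)
        (h : PseudoRiemannianMetric (𝓡 3) ∞ (EuclideanSpace ℝ (Fin 3)) (TangentSpace (𝓡 3) : N → Type _))
        (_ : h.HasLeviCivita) (φ : N → ℝ) (hh : h.IsRiemannian),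
        (∀ (y : N) (r : NNReal), IsCompact {z : N | h.edist hh y z ≤ r}) ∧
        ContMDiff (𝓡 3) 𝓘(ℝ, ℝ) ∞ φ ∧
        (∀ (y : N) (X Y : TangentSpace (𝓡 3) y),
          h.ricci y X Y + h.hessian φ y X Y = (1 / 2 : ℝ) * h.val y X Y) ∧
        (∀ y : N, h.scalarCurvature y + h.gradSq φ y = φ y) ∧
        (∃ y : N, h.scalarCurvature y ≠ 0) ∧
        (∀ R η : ℝ, 0 < η → ∃ (U : Set (N × ℝ)) (Φ : N × ℝ → M) (Ψ : M → N × ℝ), IsOpen U ∧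
          {y : N | φ y < R} ×ˢ Set.Ioo (-R) R ⊆ U ∧ ContMDiffOn ((𝓡 3).prod 𝓘(ℝ, ℝ)) (𝓡 4) ∞ Φ U ∧
          IsOpen (Φ '' U) ∧ ContMDiffOn (𝓡 4) ((𝓡 3).prod 𝓘(ℝ, ℝ)) ∞ Ψ (Φ '' U) ∧ (∀ p ∈ U, Ψ (Φ p) = p) ∧
          (∀ p ∈ U, ∀ (v : EuclideanSpace ℝ (Fin 3)) (s : ℝ),
            (1 - η) * (h.val p.1 v v + s ^ 2) ≤
                g.val (Φ p) (mfderiv ((𝓡 3).prod 𝓘(ℝ, ℝ)) (𝓡 4) Φ p (v, s))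
                  (mfderiv ((𝓡 3).prod 𝓘(ℝ, ℝ)) (𝓡 4) Φ p (v, s)) ∧
              g.val (Φ p) (mfderiv ((𝓡 3).prod 𝓘(ℝ, ℝ)) (𝓡 4) Φ p (v, s))
                  (mfderiv ((𝓡 3).prod 𝓘(ℝ, ℝ)) (𝓡 4) Φ p (v, s)) ≤ (1 + η) * (h.val p.1 v v + s ^ 2)) ∧
          (∀ p ∈ U, |g.scalarCurvature (Φ p) - h.scalarCurvature p.1| ≤ η)))
    (hT : ThreeShrinkerGap) (hBE : BakryEmeryLogSobolev) :
    UnboundedCurvatureGap := by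
  intro M _ _ _ _ _ _ _ _ _ _ g _ f hg hc hf hsol hnorm _ hunb
  obtain ⟨N, _, _, _, _, _, _, _, _, _, h, _, φ, hh, hcN, hφ, hsolN, hnormN, hnfN, htrans⟩ :=
    hsplitU M g f hg hc hf hsol hnorm hunb
  have hZ := lintegral_le_of_transplants hBE M g f hg hc hf hsol hnorm N h φ hh hcN hφ hsolN hnormN htrans
  have h3 : ∫⁻ x, ENNReal.ofReal (Real.exp (-φ x)) ∂(riemannianMeasure (h.toContMDiffRiemannianMetric hh))
      ≤ ENNReal.ofReal (16 * Real.pi ^ 2 * Real.exp (-(3 : ℝ) / 2)) :=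
    hT N h φ hh hcN hφ hsolN hnormN hnfN
  calc ∫⁻ x, ENNReal.ofReal (Real.exp (-f x)) ∂(riemannianMeasure (g.toContMDiffRiemannianMetric hg))
      ≤ ENNReal.ofReal (2 * Real.sqrt Real.pi) * ∫⁻ x, ENNReal.ofReal (Real.exp (-φ x))
          ∂(riemannianMeasure (h.toContMDiffRiemannianMetric hh)) := hZ
    _ ≤ ENNReal.ofReal (2 * Real.sqrt Real.pi) * ENNReal.ofReal (16 * Real.pi ^ 2 * Real.exp (-(3 : ℝ) / 2)) := by
        gcongr
    _ = ENNReal.ofReal (32 * Real.pi ^ 2 * Real.sqrt Real.pi * Real.exp (-(3 : ℝ) / 2)) :=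
        lineFactor_mul_threeBound

/-! ## 3. The blow-down comparison -/

/-- **`UnboundedCurvatureGap` from the blow-down comparison and the 3-d rung.** The first hypothesis is the ONE
missing step typed by the wave-1 worker of line `collapsed-ends-usc` (`UnboundedCurvatureBlowdownReduction`,
evidence `StubUnboundedCurvatureGap-verdicts.md` on stmt-SmoothPoincare4-10868): on the unbounded class either
`∫_M e^{-f} ≤ 8π²` (density `≤ 1/2`: the blow-down of a blow-up sequence at infinity is a flat quotient `ℝ⁴/Γ` or an
orbifold shrinker with a cone point) or there is a complete connected non-flat normalised 3-d shrinker `(N, h, φ)`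
with `∫_M e^{-f} ≤ 2√π ∫_N e^{-φ}` (the blow-down splits a line; Nash-entropy monotonicity). It is NOT a theorem
in print (Bamler 2020abc compactness/structure theory is printed for compact flows; the splitting needs
`R(x_i) = o(f(x_i))` along the blow-up sequence, cf. Naber 2010 Lemma 4.1, Bertellotti–Buzano 2025 Thm 1.8). Given
it, the item is `eightPiSq_le_cylinderBound` `∨` (`ThreeShrinkerGap` and `2√π · 16π² e^{-3/2} = 32π²√π e^{-3/2}`).
Conditional record; closes nothing. [cite: CaoHamiltonIlmanen2004, §4] [cite: BernsteinWang2016, Thm 1.2] -/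
theorem unboundedCurvatureGap_of_blowdownComparison
    (hred : ∀ (M : Type) [TopologicalSpace M] [T2Space M] [SecondCountableTopology M]
      [ChartedSpace (EuclideanSpace ℝ (Fin 4)) M] [IsManifold (𝓡 4) ∞ M] [ConnectedSpace M] [NoncompactSpace M]
      [T3Space M] [MeasurableSpace M] [BorelSpace M]
      (g : PseudoRiemannianMetric (𝓡 4) ∞ (EuclideanSpace ℝ (Fin 4)) (TangentSpace (𝓡 4) : M → Type _))
      [g.HasLeviCivita] (f : M → ℝ) (hg : g.IsRiemannian),
      (∀ (x : M) (r : NNReal), IsCompact {y : M | g.edist hg x y ≤ r}) →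
      ContMDiff (𝓡 4) 𝓘(ℝ, ℝ) ∞ f →
      (∀ (x : M) (X Y : TangentSpace (𝓡 4) x),
        g.ricci x X Y + g.hessian f x X Y = (1 / 2 : ℝ) * g.val x X Y) →
      (∀ x : M, g.scalarCurvature x + g.gradSq f x = f x) →
      (¬ ∃ C : ℝ, ∀ x : M, g.scalarCurvature x ≤ C) →
      ∫⁻ x, ENNReal.ofReal (Real.exp (-f x)) ∂(riemannianMeasure (g.toContMDiffRiemannianMetric hg)) ≤
          ENNReal.ofReal (8 * Real.pi ^ 2) ∨
      ∃ (N : Type) (_ : TopologicalSpace N) (_ : T2Space N) (_ : SecondCountableTopology N)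
        (_ : ChartedSpace (EuclideanSpace ℝ (Fin 3)) N) (_ : IsManifold (𝓡 3) ∞ N) (_ : ConnectedSpace N)
        (_ : T3Space N) (_ : MeasurableSpace N) (_ : BorelSpace N)
        (h : PseudoRiemannianMetric (𝓡 3) ∞ (EuclideanSpace ℝ (Fin 3)) (TangentSpace (𝓡 3) : N → Type _))
        (_ : h.HasLeviCivita) (φ : N → ℝ) (hh : h.IsRiemannian),
        (∀ (y : N) (r : NNReal), IsCompact {z : N | h.edist hh y z ≤ r}) ∧
        ContMDiff (𝓡 3) 𝓘(ℝ, ℝ) ∞ φ ∧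
        (∀ (y : N) (X Y : TangentSpace (𝓡 3) y),
          h.ricci y X Y + h.hessian φ y X Y = (1 / 2 : ℝ) * h.val y X Y) ∧
        (∀ y : N, h.scalarCurvature y + h.gradSq φ y = φ y) ∧
        (∃ y : N, h.scalarCurvature y ≠ 0) ∧
        ∫⁻ x, ENNReal.ofReal (Real.exp (-f x)) ∂(riemannianMeasure (g.toContMDiffRiemannianMetric hg)) ≤
          ENNReal.ofReal (2 * Real.sqrt Real.pi) *
            ∫⁻ y, ENNReal.ofReal (Real.exp (-φ y)) ∂(riemannianMeasure (h.toContMDiffRiemannianMetric hh)))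
    (hT : ThreeShrinkerGap) :
    UnboundedCurvatureGap := by
  intro M _ _ _ _ _ _ _ _ _ _ g _ f hg hc hf hsol hnorm _ hunb
  rcases hred M g f hg hc hf hsol hnorm hunb with hhalf |
    ⟨N, _, _, _, _, _, _, _, _, _, h, _, φ, hh, hcN, hφ, hsolN, hnormN, hnfN, hZ⟩
  · exact hhalf.trans (ENNReal.ofReal_le_ofReal eightPiSq_le_cylinderBound)
  · have h3 : ∫⁻ x, ENNReal.ofReal (Real.exp (-φ x)) ∂(riemannianMeasure (h.toContMDiffRiemannianMetric hh))
        ≤ ENNReal.ofReal (16 * Real.pi ^ 2 * Real.exp (-(3 : ℝ) / 2)) :=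
      hT N h φ hh hcN hφ hsolN hnormN hnfN
    calc ∫⁻ x, ENNReal.ofReal (Real.exp (-f x)) ∂(riemannianMeasure (g.toContMDiffRiemannianMetric hg))
        ≤ ENNReal.ofReal (2 * Real.sqrt Real.pi) * ∫⁻ x, ENNReal.ofReal (Real.exp (-φ x))
            ∂(riemannianMeasure (h.toContMDiffRiemannianMetric hh)) := hZ
      _ ≤ ENNReal.ofReal (2 * Real.sqrt Real.pi) *
            ENNReal.ofReal (16 * Real.pi ^ 2 * Real.exp (-(3 : ℝ) / 2)) := by gcongr
      _ = ENNReal.ofReal (32 * Real.pi ^ 2 * Real.sqrt Real.pi * Real.exp (-(3 : ℝ) / 2)) :=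
          lineFactor_mul_threeBound

end Summit.SmoothPoincare4.SmoothPoincare4.Theorems.UnboundedCurvatureGapReductions

end
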